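import Mathlib
import Literature.NumberTheory.LFunctions.RiemannXiHadamardProduct
import Literature.NumberTheory.LFunctions.RiemannXiLogDeriv
import Literature.NumberTheory.LFunctions.RiemannHypothesisUpTo101
import Literature.NumberTheory.LFunctions.ZetaFirstZeroCertificate
import Summits.RiemannHypothesis.RiemannHypothesis.Theorems.LeeYangLeeyangGhsFaceXiPair
import Summits.RiemannHypothesis.RiemannHypothesis.Theorems.LeeYangLeeyangCumulantAlternationXiSeries

/-!
# RiemannHypothesis / LeeYang — `LeeyangGhsFaceXi`, part 2: concavity of `Re ξ'/ξ` on `[1/2, 24]`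

Helper file for item stmt-RiemannHypothesis-0454. With a Hadamard sequence `b` of `H₀`
(`Literature.NumberTheory.LFunctions.exists_isHadamardSeq`), the tree's partial-fraction series
`Re ξ'/ξ(s) = Σₙ Re[1/(s−ρₙ) + 1/(s−(1−ρₙ))]` (`IsHadamardSeq.re_logDeriv_riemannXi_eq_tsum`)
expresses `D(σ) = Re ξ'/ξ(σ)` on the real axis as a pointwise sum of pair terms. Every `ρₙ` is a
nontrivial zero of `ζ`, hence `|Im ρₙ| > 14` (`N(14) = 0`, kernel certificate
`ZetaFirstZeroCertificate`) and `Re ρₙ = 1/2` whenever `|Im ρₙ| ≤ 101` (`RiemannHypothesisUpTo101`);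
by part 1 each pair term is concave on `[1/2, 24]`, hence so is `D` (`ξ(σ) ≠ 0` on the real axis is
`Summit.RiemannHypothesis.LeeYang.riemannXi_ofReal_ne_zero`, file `LeeYangLeeyangCumulantAlternationXiSeries`).
-/

noncomputable section

open Complex Set Literature.NumberTheory.LFunctions

-- D-0017: single-problem summit ⇒ namespace `Summit.RiemannHypothesis.RiemannHypothesis.…` by design
-- (the Summits library sets `weak.linter.dupNamespace = false`; repeated here for stand-alone checks).
set_option linter.dupNamespace false

namespace Summit.RiemannHypothesis.RiemannHypothesis.Theorems

/-- Every nontrivial zero of `ζ` has `|Im ρ| > 14` (`N(14) = 0` and `ζ(s̄) = conj ζ(s)`). [folklore] -/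
theorem LeeYangGhs.fourteen_lt_abs_im {ρ : ℂ} (hζ : riemannZeta ρ = 0) (h0 : 0 < ρ.re)
    (h1 : ρ.re < 1) : 14 < |ρ.im| := by
  by_contra h
  push Not at h
  have him : ρ.im ≠ 0 := im_ne_zero_of_riemannZeta_eq_zero hζ h0 h1
  rcases lt_or_gt_of_ne him with hneg | hpos
  · have h' : riemannZeta (starRingEnd ℂ ρ) = 0 := by rw [riemannZeta_conj, hζ, map_zero]
    have hpos' : 0 < (starRingEnd ℂ ρ).im := by simp only [Complex.conj_im]; linarith
    refine riemannZeta_ne_zero_of_im_pos_of_im_le_fourteen hpos' ?_ h'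
    simp only [Complex.conj_im]
    rw [abs_of_neg hneg] at h
    linarith
  · refine riemannZeta_ne_zero_of_im_pos_of_im_le_fourteen hpos ?_ hζ
    rw [abs_of_pos hpos] at h
    exact h

/-- `Re 1/(σ − ρ) = (σ − β)/((σ − β)² + γ²)` for real `σ`, `ρ = β + iγ`. [folklore] -/
theorem LeeYangGhs.re_inv_ofReal_sub (σ : ℝ) (ρ : ℂ) :
    (1 / ((σ : ℂ) - ρ)).re = (σ - ρ.re) / ((σ - ρ.re) ^ 2 + ρ.im ^ 2) := by
  rw [IsHadamardSeq.re_inv_sub_eq, Complex.sq_norm, Complex.normSq_apply]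
  simp only [sub_re, ofReal_re, sub_im, ofReal_im, zero_sub]
  ring

/-- **Concavity of a pair term at a nontrivial zero.** For a nontrivial zero `ρ` of `ζ`, the
function `σ ↦ Re[1/(σ−ρ)] + Re[1/(σ−(1−ρ))]` is concave on `[1/2, 24]`. [folklore] -/
theorem LeeYangGhs.pair_concaveOn {ρ : ℂ} (hζ : riemannZeta ρ = 0) (h0 : 0 < ρ.re) (h1 : ρ.re < 1) :
    ConcaveOn ℝ (Icc (1 / 2 : ℝ) 24)
      (fun σ : ℝ => (1 / ((σ : ℂ) - ρ)).re + (1 / ((σ : ℂ) - (1 - ρ))).re) := by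
  have h14 := LeeYangGhs.fourteen_lt_abs_im hζ h0 h1
  set β := ρ.re with hβ
  set c := ρ.im ^ 2 with hc
  have hfun : (fun σ : ℝ => (1 / ((σ : ℂ) - ρ)).re + (1 / ((σ : ℂ) - (1 - ρ))).re) =
      fun σ : ℝ => (σ - β) / ((σ - β) ^ 2 + c) + (σ - (1 - β)) / ((σ - (1 - β)) ^ 2 + c) := by
    funext σ
    rw [LeeYangGhs.re_inv_ofReal_sub, LeeYangGhs.re_inv_ofReal_sub]
    simp only [sub_re, one_re, sub_im, one_im, zero_sub, hβ, hc]
    ring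
  rw [hfun]
  have habs : (14 : ℝ) ^ 2 < ρ.im ^ 2 := by
    have := sq_lt_sq' (by linarith [abs_nonneg ρ.im]) h14
    simpa [sq_abs] using this
  refine LeeYangGhs.pairTerm_concaveOn h0 h1 ?_
  by_cases hsmall : |ρ.im| ≤ 101
  · left
    exact ⟨riemannHypothesisInStripUpTo_hundredOne ρ hζ h0 h1 hsmall, by rw [hc]; nlinarith⟩
  · right
    push Not at hsmall
    have := sq_lt_sq' (by linarith [abs_nonneg ρ.im]) hsmall
    rw [sq_abs] at this
    rw [hc]; nlinarith

/-- **`Re ξ'/ξ` is concave on `[1/2, 24]`** (Hadamard product and the low-lying zeros). [folklore] -/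
theorem LeeYangGhs.concaveOn_re_logDeriv_riemannXi_Icc :
    ConcaveOn ℝ (Icc (1 / 2 : ℝ) 24) (fun σ : ℝ => (logDeriv riemannXi (σ : ℂ)).re) := by
  obtain ⟨b, hb⟩ := exists_isHadamardSeq 0
  -- the pair terms
  let f : ℕ → ℝ → ℝ := fun n σ => if b n = 0 then (0 : ℝ) else
    (1 / ((σ : ℂ) - IsHadamardSeq.xiZero b n)).re + (1 / ((σ : ℂ) - (1 - IsHadamardSeq.xiZero b n))).re
  refine LeeYangGhs.concaveOn_of_hasSum (f := f) (convex_Icc _ _) (fun n => ?_) (fun σ _ => ?_)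
  · by_cases hn : b n = 0
    · simp only [f, hn, if_true]
      exact concaveOn_const 0 (convex_Icc _ _)
    · simp only [f, hn, if_false]
      obtain ⟨hζ, h0, h1⟩ := hb.riemannZeta_xiZero hn
      exact LeeYangGhs.pair_concaveOn hζ h0 h1
  · have hξ := Summit.RiemannHypothesis.LeeYang.riemannXi_ofReal_ne_zero σ
    have hsum := (hb.summable_pairs hξ).hasSum
    rw [← hb.logDeriv_riemannXi_eq_tsum_pairs hξ] at hsum
    have hre := Complex.reCLM.hasSum hsum
    simp only [Complex.reCLM_apply] at hre
    refine hre.congr_fun fun n => ?_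
    simp only [f]
    split_ifs with hn
    · simp
    · simp

end Summit.RiemannHypothesis.RiemannHypothesis.Theorems
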